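import Mathlib

/-!
# Shift variables for consecutive recessive Riccati variables of a Crum chain

For a chain of potentials `U₀, U₁, …` on a half-line related by the zero-energy Darboux–Crum rule
`U_{k+1} = 2 W_k² − U_k`, where `W_k` solves the Riccati equation `W_k′ = U_k − W_k²` (so that
`W_k = u_k′/u_k` for a zero-energy solution `u_k″ = U_k u_k`), this file records the elementary
algebra behind the *shift* description of the chain:

* `hasDerivAt_add_riccati`: `(W_k + W_{k+1})′ = W_k² − W_{k+1}²`;
* `hasDerivAt_neg_inv_add_riccati` (Bernoulli linearisation): `p := −1/(W_k + W_{k+1})` solves the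
  LINEAR equation `p′ = −1 − 2 W_k p` (so `p = u_k⁻² ∫ₓ^∞ u_k²` on the recessive branch);
* `hasDerivAt_shift`: with `D := −c/W_k` one has `D′ = c (U_k − W_k²)/W_k²`;
* `crum_next_eq_shift`: at the last rung (`c = 1`, `D = −1/W`) the TERMINAL IDENTITY
  `2W² − U = (1 − D′)/D²`;
* `shift_next_eq`: the one-step relation `D_{k+1} = (c − 1) p D_k/(D_k − c p)` between the shifts
  `D_k = −c/W_k`, `D_{k+1} = −(c − 1)/W_{k+1}`;
* `crum_next_nonneg`, `sq_mul_crum_next_le`: the residual `2W² − U` is `≥ 0` where `D′ ≤ 1`, and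
  `t² · (2W² − U)(x_f + t) ≤ K/κ²` whenever `κ ≤ D′` and `1 − D′ ≤ K` on `[x_f, ∞)` (`W < 0` there).

By these identities the residual potential of an `ℓ`-fold recessive Crum peeling is read off ONE function
`D = −1/W_{ℓ−1}` and its derivative (motivation: the far-side log-ball channel estimate for the
Regge–Wheeler family, route PhotonSphereChannels; the flat case `D = x − a` gives residual `0`).
[folklore]
-/

noncomputable section

namespace Literature.Analysis.ODE

open Set

/-- Consecutive Riccati variables of a Crum chain: if `W₁′ = U₁ − W₁²`, `W₂′ = U₂ − W₂²` and
`U₂ = 2W₁² − U₁` at `x`, then `(W₁ + W₂)′ = W₁² − W₂²` at `x`. [folklore] -/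
theorem hasDerivAt_add_riccati {W₁ W₂ U₁ U₂ : ℝ → ℝ} {x : ℝ}
    (h₁ : HasDerivAt W₁ (U₁ x - W₁ x ^ 2) x) (h₂ : HasDerivAt W₂ (U₂ x - W₂ x ^ 2) x)
    (hU : U₂ x = 2 * W₁ x ^ 2 - U₁ x) :
    HasDerivAt (fun y => W₁ y + W₂ y) (W₁ x ^ 2 - W₂ x ^ 2) x := by
  have h : HasDerivAt (fun y => W₁ y + W₂ y) (U₁ x - W₁ x ^ 2 + (U₂ x - W₂ x ^ 2)) x :=
    h₁.add h₂
  refine h.congr_deriv ?_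
  rw [hU]
  ring

/-- **Bernoulli linearisation.** Under the hypotheses of `hasDerivAt_add_riccati` and
`W₁ x + W₂ x ≠ 0`, the function `p = −1/(W₁ + W₂)` satisfies the linear first-order equation
`p′ = −1 − 2 W₁ p` at `x` (for `W₁ = u′/u` its decaying solution is `p = u⁻² ∫ₓ^∞ u²`, and then
`u·p` is the next zero-energy solution of the chain). [folklore] -/
theorem hasDerivAt_neg_inv_add_riccati {W₁ W₂ U₁ U₂ : ℝ → ℝ} {x : ℝ}
    (h₁ : HasDerivAt W₁ (U₁ x - W₁ x ^ 2) x) (h₂ : HasDerivAt W₂ (U₂ x - W₂ x ^ 2) x)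
    (hU : U₂ x = 2 * W₁ x ^ 2 - U₁ x) (hS : W₁ x + W₂ x ≠ 0) :
    HasDerivAt (fun y => -1 / (W₁ y + W₂ y))
      (-1 - 2 * W₁ x * (-1 / (W₁ x + W₂ x))) x := by
  have hs := hasDerivAt_add_riccati h₁ h₂ hU
  have hinv : HasDerivAt (fun y => -((fun y => W₁ y + W₂ y)⁻¹) y)
      (-(-(W₁ x ^ 2 - W₂ x ^ 2) / (W₁ x + W₂ x) ^ 2)) x := (hs.inv hS).neg
  have hfun : (fun y => -1 / (W₁ y + W₂ y)) = fun y => -((fun y => W₁ y + W₂ y)⁻¹) y := by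
    funext y
    simp only [Pi.inv_apply]
    rw [neg_div, one_div]
  rw [hfun]
  refine hinv.congr_deriv ?_
  field_simp
  ring

/-- **Shift variable.** If `W′ = U − W²` at `x` and `W x ≠ 0`, then `D = −c/W` has derivative
`D′ = c (U − W²)/W²` at `x`. [folklore] -/
theorem hasDerivAt_shift {W U : ℝ → ℝ} {x : ℝ} (c : ℝ)
    (h : HasDerivAt W (U x - W x ^ 2) x) (hW : W x ≠ 0) :
    HasDerivAt (fun y => -c / W y) (c * (U x - W x ^ 2) / W x ^ 2) x := by
  have hinv : HasDerivAt (fun y => -c * (W⁻¹) y) (-c * (-(U x - W x ^ 2) / W x ^ 2)) x :=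
    (h.inv hW).const_mul (-c)
  have hfun : (fun y => -c / W y) = fun y => -c * (W⁻¹) y := by
    funext y
    simp only [Pi.inv_apply]
    rw [div_eq_mul_inv]
  rw [hfun]
  refine hinv.congr_deriv ?_
  ring

/-- **Terminal identity.** For `W ≠ 0`, with `D := −1/W` and `D′ := (U − W²)/W²` (the derivative of
`D` along a Riccati solution, `hasDerivAt_shift` with `c = 1`): `2W² − U = (1 − D′)/D²`.  Thus the
next Crum potential is the defect `1 − D′` of the shift, divided by `D²`. [folklore] -/
theorem crum_next_eq_shift (W U : ℝ) (hW : W ≠ 0) :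
    2 * W ^ 2 - U = (1 - (U - W ^ 2) / W ^ 2) / (-1 / W) ^ 2 := by
  field_simp
  ring

/-- **One-step shift relation.** If `p = −1/(W₁ + W₂)` with `W₁ + W₂ ≠ 0`, `W₁ = −c/D₁` with `D₁ ≠ 0`
and `D₁ − c·p ≠ 0` (then automatically `W₂ ≠ 0`), the next shift `−(c − 1)/W₂` equals
`(c − 1) p D₁/(D₁ − c p)`.
(Flat check: `D₁ = x − a`, `p = (x − a)/(2c − 1)` give `−(c−1)/W₂ = x − a`.) [folklore] -/
theorem shift_next_eq {W₁ W₂ p D₁ c : ℝ} (hp : p = -1 / (W₁ + W₂)) (hS : W₁ + W₂ ≠ 0)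
    (hD : D₁ ≠ 0) (hW₁ : W₁ = -c / D₁) (hden : D₁ - c * p ≠ 0) :
    -(c - 1) / W₂ = (c - 1) * p * D₁ / (D₁ - c * p) := by
  have hp0 : p ≠ 0 := by
    rw [hp]
    exact div_ne_zero (by norm_num) hS
  have hsum : W₁ + W₂ = -1 / p := by
    rw [hp]
    field_simp
  have hW₂' : W₂ = -1 / p + c / D₁ := by
    have : W₂ = -1 / p - W₁ := by linarith
    rw [this, hW₁]
    ring
  have hW₂'' : W₂ = (c * p - D₁) / (p * D₁) := by
    rw [hW₂']
    field_simp
    ring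
  have hnum : c * p - D₁ ≠ 0 := by
    intro h0
    apply hden
    linarith
  rw [hW₂'']
  field_simp
  ring

/-- The next Crum potential is nonnegative where the shift grows at most at unit rate:
`(U − W²)/W² ≤ 1`, `W ≠ 0` imply `0 ≤ 2W² − U`. [folklore] -/
theorem crum_next_nonneg {W U : ℝ} (hW : W ≠ 0) (h : (U - W ^ 2) / W ^ 2 ≤ 1) :
    0 ≤ 2 * W ^ 2 - U := by
  have hW2 : 0 < W ^ 2 := by positivity
  rw [div_le_one hW2] at h
  linarith

/-- **Sub-Hardy bound from shift bounds.** Let `W < 0` solve `W′ = U − W²` on `[x_f, ∞)` and let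
`D = −1/W`, `D′ = (U − W²)/W²`.  If `κ ≤ D′` and `1 − D′ ≤ K` on `[x_f, ∞)` with `κ > 0`, then for
every `t > 0`: `t² · (2 W(x_f+t)² − U(x_f+t)) ≤ K/κ²` (indeed `D(x_f + t) ≥ κ t` by the mean value
inequality and `2W² − U = (1 − D′)/D²`).  With `K ≤ κ²/16` this is the `1/16`-sub-Hardy clause of the
residual of a recessive Crum peeling. [folklore] -/
theorem sq_mul_crum_next_le {W U : ℝ → ℝ} {xf κ K : ℝ}
    (hW : ∀ x, xf ≤ x → HasDerivAt W (U x - W x ^ 2) x) (hneg : ∀ x, xf ≤ x → W x < 0)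
    (hκ : 0 < κ) (hK : 0 ≤ K)
    (hge : ∀ x, xf ≤ x → κ ≤ (U x - W x ^ 2) / W x ^ 2)
    (hle : ∀ x, xf ≤ x → 1 - (U x - W x ^ 2) / W x ^ 2 ≤ K) :
    ∀ t : ℝ, 0 < t → t ^ 2 * (2 * W (xf + t) ^ 2 - U (xf + t)) ≤ K / κ ^ 2 := by
  intro t ht
  set D : ℝ → ℝ := fun y => -1 / W y with hDdef
  have hDderiv : ∀ x, xf ≤ x → HasDerivAt D (1 * (U x - W x ^ 2) / W x ^ 2) x := fun x hx =>
    hasDerivAt_shift 1 (hW x hx) (hneg x hx).ne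
  -- mean value inequality on [xf, xf + t]
  have hcont : ContinuousOn D (Icc xf (xf + t)) := fun x hx =>
    (hDderiv x hx.1).continuousAt.continuousWithinAt
  have hdiff : DifferentiableOn ℝ D (interior (Icc xf (xf + t))) := by
    rw [interior_Icc]
    exact fun x hx => (hDderiv x hx.1.le).differentiableAt.differentiableWithinAt
  have hge' : ∀ x ∈ interior (Icc xf (xf + t)), κ ≤ deriv D x := by
    rw [interior_Icc]
    intro x hx
    rw [(hDderiv x hx.1.le).deriv, one_mul]
    exact hge x hx.1.le
  have hmvt := (convex_Icc xf (xf + t)).mul_sub_le_image_sub_of_le_deriv hcont hdiff hge'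
    xf (left_mem_Icc.2 (by linarith)) (xf + t) (right_mem_Icc.2 (by linarith)) (by linarith)
  have hDxf : 0 < D xf := by
    simp only [hDdef]
    rw [neg_div, one_div, neg_pos, inv_lt_zero]
    exact hneg xf le_rfl
  have hDt : κ * t ≤ D (xf + t) := by
    have : κ * (xf + t - xf) ≤ D (xf + t) - D xf := hmvt
    rw [add_sub_cancel_left] at this
    linarith
  have hκt : 0 < κ * t := mul_pos hκ ht
  have hDpos : 0 < D (xf + t) := lt_of_lt_of_le hκt hDt
  have hxt : xf ≤ xf + t := by linarith
  have hWt : W (xf + t) ≠ 0 := (hneg _ hxt).ne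
  -- terminal identity at xf + t
  have hid := crum_next_eq_shift (W (xf + t)) (U (xf + t)) hWt
  have hDval : D (xf + t) = -1 / W (xf + t) := rfl
  rw [hid, ← hDval]
  have h1 : 1 - (U (xf + t) - W (xf + t) ^ 2) / W (xf + t) ^ 2 ≤ K := hle _ hxt
  have hD2 : 0 < D (xf + t) ^ 2 := by positivity
  calc t ^ 2 * ((1 - (U (xf + t) - W (xf + t) ^ 2) / W (xf + t) ^ 2) / D (xf + t) ^ 2)
      ≤ t ^ 2 * (K / D (xf + t) ^ 2) := by
        refine mul_le_mul_of_nonneg_left ?_ (by positivity)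
        exact div_le_div_of_nonneg_right h1 hD2.le
    _ ≤ t ^ 2 * (K / (κ * t) ^ 2) := by
        refine mul_le_mul_of_nonneg_left ?_ (by positivity)
        refine div_le_div_of_nonneg_left hK (by positivity) ?_
        exact pow_le_pow_left₀ hκt.le hDt 2
    _ = K / κ ^ 2 := by
        field_simp

end Literature.Analysis.ODE
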